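import Mathlib
import Literature.NumberTheory.GaloisRepresentations.CyclotomicCharacterReductionProofs
import Literature.NumberTheory.GaloisRepresentations.CyclotomicCharacterFrobeniusProofs
import Literature.NumberTheory.GaloisRepresentations.FrobeniusPlaces
import Literature.NumberTheory.GaloisRepresentations.RestrictFieldSemisimple
import Literature.NumberTheory.GaloisRepresentations.RatPlaceTwoProofs
import Literature.NumberTheory.GaloisRepresentations.HeckeCharacterProofs
import Literature.NumberTheory.GaloisRepresentations.ImaginaryQuadraticCyclotomicProofs
import Literature.NumberTheory.EllipticCurves.PeriodIndexSupport
import Literature.NumberTheory.Automorphic.ChebotarevArtinRepHolds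
import HarnessLib

/-!
# Inert Billerey–Menares primes for the Eisenstein pro-modular seed (stub S1)

Route `SkinnerWilesDefectOne`, crux `Summit.Langlands.Langlands.Theses.SkinnerWilesDefectOne.EisensteinProModularSeed`
(stmt-Langlands-12920), line `descend-raise-basechange`.  This file PROVES the registered stub
`stub_inertBMPrimeSupply`: for `F` imaginary quadratic, `p ≥ 5` and a continuous unit-valued
`η : Γ_ℚ → ℚ̄_pˣ` whose reduction `η̄` is odd and off the Mazur corner, there is a rational prime
`M ≠ p`, INERT in `F` (`M 𝓞_F` prime), at which `η̄` is unramified, with the Billerey–Menares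
congruence `η̄(Frob_M) · M ≡ 1 (mod 𝔪)` at every arithmetic Frobenius above `M` and Mazur's
`M ≡ 1 (mod p)` whenever `η̄ = ω̄` (Billerey–Menares 2018, Thm. 2: "infinitely many such primes";
Mazur 1977).  Everything is proved; no definition, no named fact.

* `v_intCast_le_one`, `v_intCast_lt_one_of_dvd`: residual congruences of integers in
  `ℚ̄_p = PadicAlgCl p` (`Valued.v = ‖·‖₊`).
* `exists_residualKernel`: the residual kernel `{τ | ‖η τ - 1‖ < 1}` of a continuous unit-valued
  character `η : Γ_K → ℚ̄_pˣ` is an open normal subgroup.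
* `exists_inert_prime` (Chebotarev step): the arithmetic Frobenius elements at places outside a
  finite set are dense in `Γ_ℚ` (`absoluteGaloisGroup.frobenius_dense`, fed by the tree's PROVED
  `chebotarev_artinRep_holds`), so for an open normal `N ≤ Γ_ℚ` and `g` acting nontrivially on
  `F` some Frobenius `σ` above a good place `v = (M)` lies in `g (N ∩ ker χ_p ∩ Gal(ℚ̄/F))`; then
  `v` is inert in `F` (`exists_place_inert_of_not_mem_range`; `M 𝓞_F` is the unique prime above
  `M`, `Rat.isPrime_span_natCast_of_unique_place`) and `χ_p(g) = χ_p(σ) ≡ M (mod p)`.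
* `stub_inertBMPrimeSupply`: with `N` the residual kernel of `η`, if `η̄ ≠ ω̄` take `g = c` a
  complex conjugation (`η̄(Frob) = η̄(c) = -1` at every Frobenius above `M` by conjugacy of the
  primes above `M`, and `M ≡ χ_p(c) = -1`); if `η̄ = ω̄` take `g` trivial on `μ_p` and nontrivial
  on `F` (`Rat.exists_modNCyclotomicCharacter_eq_one_and_not_mem_range`, the excluded Mazur
  corner; then `M ≡ 1` and `η̄(Frob) = χ_p(Frob) = M` by
  `GaloisRep.cyclotomicCharacter_apply_of_isArithFrobAt`).

References: N. Billerey, R. Menares, *Strong modularity of reducible Galois representations*,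
Trans. AMS 370 (2018), Thm. 2 [BillereyMenares2018]; B. Mazur, *Modular curves and the Eisenstein
ideal*, Publ. IHÉS 47 (1977) [Mazur1977]; J. Tate, *Global class field theory*, in
Cassels–Fröhlich (1967), §2.4 (Chebotarev) [TateGCFT1967]; J. Neukirch, *Algebraic Number
Theory* (1999), Ch. I §§8–9 [NeukirchANT1999].
-/

-- the registered namespace `Summit.Langlands.Langlands.…` repeats `Langlands` (summit = problem)
set_option linter.dupNamespace false

noncomputable section

open Field NumberField IsDedekindDomain
open scoped Pointwise
open Literature.NumberTheory.GaloisRepresentations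

namespace Summit.Langlands.Langlands.Theorems.SkinnerWilesDefectOne.EisensteinProModularSeed

/-! ### Residual congruences in `ℚ̄_p` and the residual kernel of a character -/

variable {p : ℕ} [Fact p.Prime]

/-- `‖n‖ ≤ 1` in `ℚ̄_p` for `n ∈ ℤ`. [folklore] -/
theorem v_intCast_le_one (n : ℤ) : Valued.v (n : PadicAlgCl p) ≤ 1 := by
  rw [PadicAlgCl.valuation_def, ← map_intCast (algebraMap ℚ_[p] (PadicAlgCl p)) n,
    ← NNReal.coe_le_coe, coe_nnnorm, PadicAlgCl.norm_extends]
  exact_mod_cast Padic.norm_int_le_one n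

/-- `‖n‖ ≤ 1` in `ℚ̄_p` for `n ∈ ℕ`. [folklore] -/
theorem v_natCast_le_one (n : ℕ) : Valued.v (n : PadicAlgCl p) ≤ 1 := by
  exact_mod_cast v_intCast_le_one (p := p) (n : ℤ)

/-- `‖n‖ < 1` in `ℚ̄_p` for `n ∈ pℤ`. [folklore] -/
theorem v_intCast_lt_one_of_dvd {n : ℤ} (h : (p : ℤ) ∣ n) : Valued.v (n : PadicAlgCl p) < 1 := by
  rw [PadicAlgCl.valuation_def, ← map_intCast (algebraMap ℚ_[p] (PadicAlgCl p)) n,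
    ← NNReal.coe_lt_coe, coe_nnnorm, PadicAlgCl.norm_extends]
  exact_mod_cast Padic.norm_intCast_lt_one_iff.mpr h

/-- **The residual kernel `{τ | ‖η τ - 1‖ < 1}` of a continuous unit-valued character
`η : Γ_K → ℚ̄_pˣ` is an open normal subgroup.** [folklore] -/
theorem exists_residualKernel {K : Type*} [Field K] (η : absoluteGaloisGroup K →ₜ* (PadicAlgCl p)ˣ)
    (hunit : ∀ τ, Valued.v ((η τ : (PadicAlgCl p)ˣ) : PadicAlgCl p) = 1) :
    ∃ H : Subgroup (absoluteGaloisGroup K),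
      (∀ τ, τ ∈ H ↔ Valued.v (((η τ : (PadicAlgCl p)ˣ) : PadicAlgCl p) - 1) < 1) ∧
      H.Normal ∧ IsOpen (H : Set (absoluteGaloisGroup K)) := by
  set f : absoluteGaloisGroup K → PadicAlgCl p := fun τ => ((η τ : (PadicAlgCl p)ˣ) : PadicAlgCl p)
  have hf : ∀ τ, ((η τ : (PadicAlgCl p)ˣ) : PadicAlgCl p) = f τ := fun _ => rfl
  simp only [hf] at hunit ⊢
  have hmul : ∀ σ τ, f (σ * τ) = f σ * f τ := fun σ τ => by simp [← hf]
  let H : Subgroup (absoluteGaloisGroup K) :=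
    { carrier := {τ | Valued.v (f τ - 1) < 1}
      mul_mem' := fun {σ τ} hσ hτ => by
        have e : f σ * f τ - 1 = f σ * (f τ - 1) + (f σ - 1) := by ring
        simp only [Set.mem_setOf_eq, hmul, e] at hσ hτ ⊢
        refine Valuation.map_add_lt _ ?_ hσ
        rwa [Valuation.map_mul, hunit, one_mul]
      one_mem' := by simp [← hf]
      inv_mem' := fun {σ} hσ => by
        have e : f σ⁻¹ - 1 = -(f σ⁻¹ * (f σ - 1)) := by
          rw [mul_sub, ← hmul, inv_mul_cancel, mul_one]; simp [← hf]
        simp only [Set.mem_setOf_eq] at hσ ⊢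
        rwa [e, Valuation.map_neg, Valuation.map_mul, hunit, one_mul] }
  refine ⟨H, fun τ => Iff.rfl, ⟨fun τ hτ g => ?_⟩, ?_⟩
  · change Valued.v (f (g * τ * g⁻¹) - 1) < 1
    have e : f (g * τ * g⁻¹) = f τ := by
      simp only [← hf, map_mul, map_inv, mul_inv_cancel_comm]
    rw [e]; exact hτ
  · have hball : {x : PadicAlgCl p | Valued.v (x - 1) < 1} = Metric.ball (1 : PadicAlgCl p) 1 := by
      ext x
      rw [Metric.mem_ball, dist_eq_norm, Set.mem_setOf_eq, PadicAlgCl.valuation_def,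
        ← NNReal.coe_lt_coe, coe_nnnorm]
      norm_num
    change IsOpen (f ⁻¹' {x : PadicAlgCl p | Valued.v (x - 1) < 1})
    rw [hball]
    exact Metric.isOpen_ball.preimage (Units.continuous_val.comp η.continuous_toFun)

/-! ### The Chebotarev step and the stub -/

/-- **The prime `M` of the line (Chebotarev step).**  `F` imaginary quadratic (Galois of degree
`2` over `ℚ`), `p` a prime, `N ≤ Γ_ℚ` an open normal subgroup and `g ∈ Γ_ℚ` acting nontrivially
on `F`.  There is a rational prime `M ≠ p`, INERT in `F` (`M 𝓞_F` prime), below a place `v` of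
`ℚ` unramified for `N` (all inertia groups above `v` lie in `N`), with `χ_p(g) ≡ M (mod p)` and an
arithmetic Frobenius `σ` above `v` in the coset `g N`.  Proof: the arithmetic Frobenius elements at
places outside a finite set are dense in `Γ_ℚ` (Chebotarev, `absoluteGaloisGroup.frobenius_dense`
fed by the tree's proved `chebotarev_artinRep_holds`), so one lies in the open coset
`g (N ∩ ker χ_p ∩ Gal(ℚ̄/F))` and above a place `v ∤ p` unramified in `F` and for `N`,
`Gal(ℚ̄/F)`; it acts nontrivially on `F`, so `v` is inert (`exists_place_inert_of_not_mem_range`),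
and `χ_p(σ) = N v = M` (`modNCyclotomicCharacter_eq_residueCard_of_isArithFrobAt`). [folklore] -/
theorem exists_inert_prime (F : Type) [Field F] [NumberField F] [IsGalois ℚ F]
    (h2 : Module.finrank ℚ F = 2) (p : ℕ) [Fact p.Prime] [NeZero (p : ℚ)]
    (N : Subgroup (absoluteGaloisGroup ℚ)) [N.Normal] (hN : IsOpen (N : Set (absoluteGaloisGroup ℚ)))
    {g : absoluteGaloisGroup ℚ}
    (hg : g ∉ ((absGaloisRestrict ℚ F).range : Subgroup (absoluteGaloisGroup ℚ))) :
    ∃ (M : ℕ) (v : HeightOneSpectrum (𝓞 ℚ)), M.Prime ∧ M ≠ p ∧ (M : 𝓞 ℚ) ∈ v.asIdeal ∧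
      (p : 𝓞 ℚ) ∉ v.asIdeal ∧
      (∀ w : HeightOneSpectrum (𝓞 ℚ), (M : 𝓞 ℚ) ∈ w.asIdeal → w = v) ∧
      (Ideal.span {(M : 𝓞 F)}).IsPrime ∧
      (∀ 𝔓 ∈ v.primesAbove, 𝔓.inertia (absoluteGaloisGroup ℚ) ≤ N) ∧
      ((modNCyclotomicCharacter ℚ p g : (ZMod p)ˣ) : ZMod p) = M ∧
      ∃ 𝔓 ∈ v.primesAbove, ∃ σ : absoluteGaloisGroup ℚ, IsArithFrobAt (𝓞 ℚ) σ 𝔓 ∧ g⁻¹ * σ ∈ N := by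
  classical
  haveI : NeZero p := ⟨(Fact.out : p.Prime).ne_zero⟩
  haveI : FiniteDimensional ℚ F := Module.finite_of_finrank_eq_succ h2
  have hprime : (Module.finrank ℚ F).Prime := by rw [h2]; exact Nat.prime_two
  set HF : Subgroup (absoluteGaloisGroup ℚ) := (absGaloisRestrict ℚ F).range with hHF
  haveI hHFn : HF.Normal := normal_range_absGaloisRestrict ℚ F
  have hHFi : HF.index = Module.finrank ℚ F := SorensenPatching.index_range_absGaloisRestrict ℚ F
  have hHFo : IsOpen (HF : Set (absoluteGaloisGroup ℚ)) :=
    SorensenPatching.isOpen_range_absGaloisRestrict ℚ F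
  set ω := modNCyclotomicCharacter ℚ p with hω
  have hKo : IsOpen (ω.ker : Set (absoluteGaloisGroup ℚ)) :=
    Subgroup.isOpen_of_mem_nhds _ (g := 1) (modNCyclotomicCharacter_eventually_eq_one ℚ p)
  -- the open coset `U = g (N ∩ ker ω ∩ HF)`
  set N' : Subgroup (absoluteGaloisGroup ℚ) := N ⊓ ω.ker ⊓ HF with hN'
  have hN'o : IsOpen (N' : Set (absoluteGaloisGroup ℚ)) := (hN.inter hKo).inter hHFo
  set U : Set (absoluteGaloisGroup ℚ) := (fun σ => g⁻¹ * σ) ⁻¹' (N' : Set (absoluteGaloisGroup ℚ))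
    with hU
  have hUo : IsOpen U := hN'o.preimage (continuous_const_mul g⁻¹)
  have hgU : g ∈ U := by
    change g⁻¹ * g ∈ N'
    rw [inv_mul_cancel]
    exact one_mem _
  -- the finite set of bad places
  have hS1 : {v : HeightOneSpectrum (𝓞 ℚ) | (p : 𝓞 ℚ) ∈ v.asIdeal}.Finite := by
    have hne : Ideal.span {(p : 𝓞 ℚ)} ≠ ⊥ := by
      rw [Ne, Ideal.span_singleton_eq_bot]
      exact_mod_cast (Fact.out : p.Prime).ne_zero
    refine (Ideal.finite_factors hne).subset fun v hv => ?_
    simpa [Ideal.dvd_span_singleton] using hv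
  have hS2 : {v : HeightOneSpectrum (𝓞 ℚ) |
      ¬ ∀ 𝔓 ∈ v.primesAbove, 𝔓.inertia (absoluteGaloisGroup ℚ) ≤ N}.Finite :=
    Filter.eventually_cofinite.mp (Literature.NumberTheory.EllipticCurves.eventually_forall_inertia_le N hN)
  have hS3 : {v : HeightOneSpectrum (𝓞 ℚ) |
      ¬ ∀ 𝔓 ∈ v.primesAbove, 𝔓.inertia (absoluteGaloisGroup ℚ) ≤ HF}.Finite :=
    Filter.eventually_cofinite.mp (Literature.NumberTheory.EllipticCurves.eventually_forall_inertia_le HF hHFo)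
  have hS4 : {v : HeightOneSpectrum (𝓞 ℚ) | ¬ Algebra.IsUnramifiedIn (𝓞 F) v.asIdeal}.Finite :=
    finite_setOf_not_isUnramifiedIn ℚ F
  set S : Set (HeightOneSpectrum (𝓞 ℚ)) :=
    (({v | (p : 𝓞 ℚ) ∈ v.asIdeal} ∪
      {v | ¬ ∀ 𝔓 ∈ v.primesAbove, 𝔓.inertia (absoluteGaloisGroup ℚ) ≤ N}) ∪
      {v | ¬ ∀ 𝔓 ∈ v.primesAbove, 𝔓.inertia (absoluteGaloisGroup ℚ) ≤ HF}) ∪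
      {v | ¬ Algebra.IsUnramifiedIn (𝓞 F) v.asIdeal} with hSdef
  have hS : S.Finite := ((hS1.union hS2).union hS3).union hS4
  -- Chebotarev: a Frobenius in `U` above a place outside `S`
  have hD := absoluteGaloisGroup.frobenius_dense
    Literature.NumberTheory.Automorphic.chebotarev_artinRep_holds ℚ S hS
  obtain ⟨σ, hσU, v, hvS, 𝔓, h𝔓, hσ⟩ := hD.inter_open_nonempty U hUo ⟨g, hgU⟩
  have hv1 : (p : 𝓞 ℚ) ∉ v.asIdeal := fun h => hvS (Or.inl (Or.inl (Or.inl h)))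
  have hv2 : ∀ 𝔓 ∈ v.primesAbove, 𝔓.inertia (absoluteGaloisGroup ℚ) ≤ N := by
    by_contra h; exact hvS (Or.inl (Or.inl (Or.inr h)))
  have hv3 : ∀ 𝔓 ∈ v.primesAbove, 𝔓.inertia (absoluteGaloisGroup ℚ) ≤ HF := by
    by_contra h; exact hvS (Or.inl (Or.inr h))
  have hv4 : Algebra.IsUnramifiedIn (𝓞 F) v.asIdeal := by
    by_contra h; exact hvS (Or.inr h)
  have hσN : g⁻¹ * σ ∈ N := hσU.1.1
  have hσK : g⁻¹ * σ ∈ ω.ker := hσU.1.2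
  have hσH : g⁻¹ * σ ∈ HF := hσU.2
  -- the prime `M` below `v`
  set M := Rat.HeightOneSpectrum.natGenerator v with hMdef
  have hMprime : M.Prime := Rat.HeightOneSpectrum.prime_natGenerator v
  have hMv : (M : 𝓞 ℚ) ∈ v.asIdeal := (Rat.natCast_mem_asIdeal_iff v).mpr dvd_rfl
  have hMp : M ≠ p := fun h => hv1 (h ▸ hMv)
  have huniqv : ∀ w : HeightOneSpectrum (𝓞 ℚ), (M : 𝓞 ℚ) ∈ w.asIdeal → w = v := fun w hw =>
    Rat.natGenerator_injective ((Rat.natGenerator_eq_of_prime_mem w hMprime hw).trans rfl)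
  -- `ω σ = M` and `ω g = ω σ`
  have hpP : (p : absIntegers (𝓞 ℚ) ℚ) ∉ 𝔓 := absIntegers.natCast_notMem_of_mem_primesAbove hv1 h𝔓
  have hωσ : (ω σ : ZMod p) = M := by
    rw [hω, modNCyclotomicCharacter_eq_residueCard_of_isArithFrobAt h𝔓 hpP hσ,
      Rat.residueCard_eq_natGenerator]
  have hωg : ω g = ω σ := by
    rw [MonoidHom.mem_ker, map_mul, map_inv, inv_mul_eq_one] at hσK
    exact hσK
  -- `σ ∉ HF`, so `v` is inert in `F`
  have hσHF : σ ∉ HF := fun h => hg (by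
    have := HF.mul_mem h (HF.inv_mem hσH)
    rwa [mul_inv_rev, inv_inv, mul_inv_cancel_left] at this)
  obtain ⟨w, -, -, hwv, huniq, -, -⟩ :=
    exists_place_inert_of_not_mem_range (F := ℚ) (M := F) hprime hHFn hHFi hv4 h𝔓 (hv3 𝔓 h𝔓)
      hσ hσHF
  have hspan : (Ideal.span {(M : 𝓞 F)}).IsPrime :=
    Rat.isPrime_span_natCast_of_unique_place F (Rat.asIdeal_eq_span_natGenerator v) hv4 hwv huniq
  exact ⟨M, v, hMprime, hMp, hMv, hv1, huniqv, hspan, hv2, by rw [← hωσ, ← hωg], 𝔓, h𝔓, σ, hσ, hσN⟩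


/-- **stub_inertBMPrimeSupply** (line `descend-raise-basechange`, S1): for `F` imaginary
quadratic, `p ≥ 5` and a continuous unit-valued `η : Γ_ℚ → ℚ̄_pˣ` with odd reduction `η̄` off the
Mazur corner, there is a prime `M ≠ p` INERT in `F` at which `η̄` is unramified, with the
Billerey–Menares congruence `η̄(Frob_M)·M ≡ 1` at every arithmetic Frobenius above `M` and
Mazur's `M ≡ 1 (mod p)` when `η̄ = ω̄`.  Proof: Chebotarev (`exists_inert_prime`) for the residual
kernel `N` of `η` and `g = c` a complex conjugation if `η̄ ≠ ω̄` (`η̄(Frob) = η̄(c) = -1`,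
`M ≡ χ_p(c) = -1`), resp. `g` trivial on `μ_p` and nontrivial on `F` if `η̄ = ω̄`
(`Rat.exists_modNCyclotomicCharacter_eq_one_and_not_mem_range`; then `M ≡ 1` and `η̄(Frob) = χ_p(Frob) = M`).
BillereyMenares2018 Thm. 2; Mazur1977. [folklore] -/
theorem stub_inertBMPrimeSupply :
    ∀ (F : Type) [Field F] [NumberField F], NumberField.IsTotallyComplex F → Module.finrank ℚ F = 2 →
      ∀ (p : ℕ) [Fact p.Prime], 5 ≤ p →
      ∀ (η : Field.absoluteGaloisGroup ℚ →ₜ* (PadicAlgCl p)ˣ),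
      (∀ τ, Valued.v ((η τ : (PadicAlgCl p)ˣ) : PadicAlgCl p) = 1) →
      (∀ c : Field.absoluteGaloisGroup ℚ, Literature.NumberTheory.GaloisRepresentations.IsComplexConjugation (Rat.castHom ℝ) c →
        Valued.v (((η c : (PadicAlgCl p)ˣ) : PadicAlgCl p) + 1) < 1) →
      ¬ ((∀ τ, Valued.v (((η τ : (PadicAlgCl p)ˣ) : PadicAlgCl p) - (algebraMap (Padic p) (PadicAlgCl p) (((Literature.NumberTheory.GaloisRepresentations.GaloisRep.cyclotomicCharacter ℚ p τ).val : PadicInt p) : Padic p))) < 1) ∧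
          p % 4 = 3 ∧ ∃ x : F, x ^ 2 = -(p : F)) →
      ∃ M : ℕ, M.Prime ∧ M ≠ p ∧ (Ideal.span {(M : NumberField.RingOfIntegers F)}).IsPrime ∧
        (∀ w : IsDedekindDomain.HeightOneSpectrum (NumberField.RingOfIntegers ℚ), (M : NumberField.RingOfIntegers ℚ) ∈ w.asIdeal → ∀ 𝔓 ∈ w.primesAbove,
          ∀ σ ∈ 𝔓.inertia (Field.absoluteGaloisGroup ℚ),
            Valued.v (((η σ : (PadicAlgCl p)ˣ) : PadicAlgCl p) - 1) < 1) ∧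
        (∀ w : IsDedekindDomain.HeightOneSpectrum (NumberField.RingOfIntegers ℚ), (M : NumberField.RingOfIntegers ℚ) ∈ w.asIdeal → ∀ 𝔓 ∈ w.primesAbove,
          ∀ σ : Field.absoluteGaloisGroup ℚ, IsArithFrobAt (NumberField.RingOfIntegers ℚ) σ 𝔓 →
            Valued.v (((η σ : (PadicAlgCl p)ˣ) : PadicAlgCl p) * (M : PadicAlgCl p) - 1) < 1) ∧
        ((∀ τ, Valued.v (((η τ : (PadicAlgCl p)ˣ) : PadicAlgCl p) - (algebraMap (Padic p) (PadicAlgCl p) (((Literature.NumberTheory.GaloisRepresentations.GaloisRep.cyclotomicCharacter ℚ p τ).val : PadicInt p) : Padic p))) < 1) → M % p = 1) := by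
  intro F _ _ hF h2 p _ hp5 η hunit hodd hcorner
  classical
  haveI : NeZero p := ⟨(Fact.out : p.Prime).ne_zero⟩
  haveI : NeZero (p : ℚ) := NeZero.charZero
  haveI : FiniteDimensional ℚ F := Module.finite_of_finrank_eq_succ h2
  haveI : Algebra.IsQuadraticExtension ℚ F := ⟨h2⟩
  haveI : IsGalois ℚ F := inferInstance
  obtain ⟨Hη, hHη, hHηn, hHηo⟩ := exists_residualKernel η hunit
  haveI := hHηn
  set ω := modNCyclotomicCharacter ℚ p with hω
  -- the unramifiedness clause, common to both cases
  have unram : ∀ {M : ℕ} {v : HeightOneSpectrum (𝓞 ℚ)},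
      (∀ w : HeightOneSpectrum (𝓞 ℚ), (M : 𝓞 ℚ) ∈ w.asIdeal → w = v) →
      (∀ 𝔓 ∈ v.primesAbove, 𝔓.inertia (absoluteGaloisGroup ℚ) ≤ Hη) →
      ∀ w : HeightOneSpectrum (𝓞 ℚ), (M : 𝓞 ℚ) ∈ w.asIdeal → ∀ 𝔓 ∈ w.primesAbove,
        ∀ σ ∈ 𝔓.inertia (absoluteGaloisGroup ℚ),
          Valued.v (((η σ : (PadicAlgCl p)ˣ) : PadicAlgCl p) - 1) < 1 := by
    intro M v huniqv hIN w hw 𝔓' h𝔓' i hi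
    obtain rfl := huniqv w hw
    exact (hHη i).mp (hIN 𝔓' h𝔓' hi)
  by_cases hB : ∀ τ, Valued.v (((η τ : (PadicAlgCl p)ˣ) : PadicAlgCl p) -
      (algebraMap (Padic p) (PadicAlgCl p)
        (((GaloisRep.cyclotomicCharacter ℚ p τ).val : PadicInt p) : Padic p))) < 1
  · /- Case `η̄ = ω̄`: a Frobenius trivial on `μ_p` and nontrivial on `F` -/
    have hcorner' : ¬ (p % 4 = 3 ∧ ∃ x : F, x ^ 2 = -(p : F)) := fun h => hcorner ⟨hB, h⟩
    obtain ⟨g, hg1, hgF⟩ := Rat.exists_modNCyclotomicCharacter_eq_one_and_not_mem_range F hF h2 hp5 hcorner'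
    obtain ⟨M, v, hMprime, hMp, hMv, hpv, huniqv, hspan, hIN, hωg, 𝔓, h𝔓, σ, hσ, hσN⟩ :=
      exists_inert_prime F h2 p Hη hHηo hgF
    have hM1 : (M : ZMod p) = 1 := by rw [← hωg, hg1, Units.val_one]
    have hMmod : M % p = 1 := by
      have h := (ZMod.natCast_eq_natCast_iff' M 1 p).mp (by rw [hM1, Nat.cast_one])
      rwa [Nat.mod_eq_of_lt (Fact.out : p.Prime).one_lt] at h
    have hdvd : (p : ℤ) ∣ (M : ℤ) * M - 1 :=
      (ZMod.intCast_zmod_eq_zero_iff_dvd _ p).mp (by push_cast; rw [hM1]; ring)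
    refine ⟨M, hMprime, hMp, hspan, unram huniqv hIN, ?_, fun _ => hMmod⟩
    intro w hw 𝔓' h𝔓' σ' hσ'
    obtain rfl := huniqv w hw
    have hgen : Rat.HeightOneSpectrum.natGenerator w = M := Rat.natGenerator_eq_of_prime_mem w hMprime hMv
    have hcyc := GaloisRep.cyclotomicCharacter_apply_of_isArithFrobAt (ℓ := p) hpv h𝔓' hσ'
    rw [Rat.residueCard_eq_natGenerator, hgen] at hcyc
    have h1 := hB σ'
    rw [show ((GaloisRep.cyclotomicCharacter ℚ p σ').val : ℤ_[p]) = (M : ℤ_[p]) from hcyc,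
      PadicInt.coe_natCast, map_natCast] at h1
    have e : ((η σ' : (PadicAlgCl p)ˣ) : PadicAlgCl p) * (M : PadicAlgCl p) - 1 =
        (((η σ' : (PadicAlgCl p)ˣ) : PadicAlgCl p) - M) * M + (((M : ℤ) * M - 1 : ℤ) : PadicAlgCl p) := by
      push_cast; ring
    rw [e]
    refine Valuation.map_add_lt _ ?_ (v_intCast_lt_one_of_dvd hdvd)
    rw [Valuation.map_mul]
    exact lt_of_le_of_lt (mul_le_of_le_one_right zero_le (v_natCast_le_one M)) h1
  · /- Case `η̄ ≠ ω̄`: a Frobenius in the class of complex conjugation -/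
    obtain ⟨c, hc⟩ := exists_isComplexConjugation (K := ℚ) (Rat.castHom ℝ)
    have hcF := Rat.not_mem_range_absGaloisRestrict_of_isComplexConjugation F hF hc
    obtain ⟨M, v, hMprime, hMp, hMv, hpv, huniqv, hspan, hIN, hωg, 𝔓, h𝔓, σ, hσ, hσN⟩ :=
      exists_inert_prime F h2 p Hη hHηo hcF
    have hωc : (ω c : ZMod p) = -1 := modNCyclotomicCharacter_of_isComplexConjugation hc
    have hdvd : (p : ℤ) ∣ (M : ℤ) + 1 :=
      (ZMod.intCast_zmod_eq_zero_iff_dvd _ p).mp (by push_cast; rw [← hωg, ← hω, hωc]; ring)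
    refine ⟨M, hMprime, hMp, hspan, unram huniqv hIN, ?_, fun h => absurd h hB⟩
    intro w hw 𝔓' h𝔓' σ' hσ'
    obtain rfl := huniqv w hw
    -- transport the Frobenius `σ` at `𝔓` to `𝔓'`
    obtain ⟨τ, hτ⟩ := HeightOneSpectrum.exists_smul_eq_of_mem_primesAbove_holds h𝔓 h𝔓'
    have hconj : IsArithFrobAt (𝓞 ℚ) (τ * σ * τ⁻¹) 𝔓' := hτ ▸ hσ.conj τ
    have hi : σ' * (τ * σ * τ⁻¹)⁻¹ ∈ 𝔓'.inertia (absoluteGaloisGroup ℚ) :=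
      hσ'.mul_inv_mem_inertia hconj
    have h1 := (hHη _).mp (hIN 𝔓' h𝔓' hi)
    have h2' := (hHη _).mp hσN
    have h3 := hodd c hc
    -- `η σ' = η(i) · η(c) · η(c⁻¹ σ)` in the abelian group `ℚ̄_pˣ`
    have e1 : η σ' = η (σ' * (τ * σ * τ⁻¹)⁻¹) * η (τ * σ * τ⁻¹) := by
      rw [← map_mul, inv_mul_cancel_right]
    have e2 : η (τ * σ * τ⁻¹) = η σ := by rw [map_mul, map_mul, map_inv, mul_inv_cancel_comm]
    have e3 : η σ = η c * η (c⁻¹ * σ) := by rw [← map_mul, mul_inv_cancel_left]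
    rw [e2, e3] at e1
    have hval : ((η σ' : (PadicAlgCl p)ˣ) : PadicAlgCl p) =
        ((η (σ' * (τ * σ * τ⁻¹)⁻¹) : (PadicAlgCl p)ˣ) : PadicAlgCl p) *
          (((η c : (PadicAlgCl p)ˣ) : PadicAlgCl p) * ((η (c⁻¹ * σ) : (PadicAlgCl p)ˣ) : PadicAlgCl p)) := by
      rw [e1, Units.val_mul, Units.val_mul]
    set x := ((η (σ' * (τ * σ * τ⁻¹)⁻¹) : (PadicAlgCl p)ˣ) : PadicAlgCl p) with hx
    set y := ((η (c⁻¹ * σ) : (PadicAlgCl p)ˣ) : PadicAlgCl p) with hy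
    set d := ((η c : (PadicAlgCl p)ˣ) : PadicAlgCl p) with hd
    have key : Valued.v (((η σ' : (PadicAlgCl p)ˣ) : PadicAlgCl p) + 1) < 1 := by
      have e : ((η σ' : (PadicAlgCl p)ˣ) : PadicAlgCl p) + 1 =
          (x - 1) * (d * y) + (d * (y - 1) + (d + 1)) := by rw [hval]; ring
      rw [e]
      refine Valuation.map_add_lt _ ?_ (Valuation.map_add_lt _ ?_ h3)
      · rw [Valuation.map_mul, Valuation.map_mul, hd, hy, hunit, hunit, mul_one, mul_one]
        exact h1
      · rw [Valuation.map_mul, hd, hunit, one_mul]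
        exact h2'
    have e : ((η σ' : (PadicAlgCl p)ˣ) : PadicAlgCl p) * (M : PadicAlgCl p) - 1 =
        (((η σ' : (PadicAlgCl p)ˣ) : PadicAlgCl p) + 1) * M + -(((M : ℤ) + 1 : ℤ) : PadicAlgCl p) := by
      push_cast; ring
    rw [e]
    refine Valuation.map_add_lt _ ?_ ?_
    · rw [Valuation.map_mul]
      exact lt_of_le_of_lt (mul_le_of_le_one_right zero_le (v_natCast_le_one M)) key
    · rw [Valuation.map_neg]
      exact v_intCast_lt_one_of_dvd hdvd

end Summit.Langlands.Langlands.Theorems.SkinnerWilesDefectOne.EisensteinProModularSeed
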